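import Mathlib.CategoryTheory.Endomorphism
import Mathlib.CategoryTheory.NatIso
import Mathlib.Algebra.Group.Hom.Defs
import HarnessLib

/-!
# Levelwise descent along a faithful functor assembles to descent of a tower (diagram) with its
# translations (Görtz–Wedhorn I, Thm. 14.72 (1) / Cor. 14.85, the bookkeeping step; Deligne 1971, Variante 5.9)

Topic `Literature/AlgebraicGeometry/Motives`, namespace `Literature.AlgebraicGeometry.Motives`.
KERNEL ONLY: theorems over Mathlib's category theory; no definition, no named fact, no instance, no `sorry`.

## What is abstracted

The tree's `Motives/GaloisDescentFunctor` (`GaloisDescentFunctor.Datum.descendedFunctor`, `isoBaseChange`,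
`map₀_unique`) descends a DIAGRAM `X : J ⥤ SchemeOver L` along a FINITE Galois extension `L/k`: object-wise descent
gives `k`-forms, morphism descent gives the transition maps, and «base change `SchemeOver k ⥤ SchemeOver L` is
faithful» makes the descended data a functor with a natural comparison isomorphism.  The last step uses nothing about
schemes.  This file isolates it for an ARBITRARY faithful functor `G : D ⥤ D'` («base change»), a diagram
`F : C ⥤ D'` («the tower upstairs»), levelwise objects `N₀ c : D` with comparisons `e₀ c : G.obj (N₀ c) ≅ F.obj c`
(«levelwise forms»), a group `Γ` acting levelwise on `F` by endomorphisms `τ c γ : F.obj c ⟶ F.obj c` commuting with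
the transition maps («Hecke translations»), and the bare EXISTENCE of lifts of the transition maps `F.map f` and of
the translations `τ c γ` to `D` («morphism descent», e.g. the tree's `GaloisDescent.existsUnique_map_eq_complex`
along `ℂ/E`).  Conclusion (`exists_functor_action_iso_of_levelwise`): a functor `N : C ⥤ D`, monoid homomorphisms
`ρ c : Γ →* Aut (N.obj c)` natural in `c`, and a natural isomorphism `e : N ⋙ G ≅ F` matching `ρ` with `τ`; moreover
ANY levelwise property `P c Z (i : G.obj Z ≅ F.obj c)` known for the given forms `(N₀ c, e₀ c)` holds for
`(N.obj c, e.app c)` — so a levelwise reciprocity law is carried along verbatim.  This is the shape of the conclusion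
of the cell's leaf `UnitaryCanonicalModel.Aux.canonicalModel_exists_ext_printed` (functor of `E`-forms, descended
class-group action, comparison `e`, reciprocity `IsCanonicalDescentAtExt N e`, which quantifies over the levels and
reads `N.obj K` and `e.inv.app K = (e.app K).inv`), with `G := Motives.baseChange E ℂ` (faithful: the tree's
instance `AbelianVariety.faithful_bcFunctor` = Mathlib `Over.faithful_pullback` is stated for the `abbrev`
`AbelianVariety.bcFunctor E ℂ`, definitionally `Motives.baseChange E ℂ` (`AbelianVariety.baseChange_eq_bcFunctor`, `rfl`), so a
consumer writes `haveI : (Motives.baseChange ↥E ℂ).Faithful := AbelianVariety.faithful_bcFunctor (K := ↥E) (L := ℂ)` —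
instance search alone does not unfold the `def`), `F := Aux.complexSystemExt`, `Γ := classGroup`, `τ := Aux.translMorExt`
(`hτ_one/hτ_mul/hτ_nat` = the tree's `Aux.translMorExt_one/_mul/_comp_map`).

* `lift_unique` — two lifts of one morphism through the comparisons agree (faithfulness).
* `exists_functor_iso_of_levelwise` — tower descent without translations: `∃ N e, ∀ c, P c (N.obj c) (e.app c)`.
* `exists_functor_action_iso_of_levelwise` — with a levelwise `Γ`-action by endomorphisms of `F` (convention of
  Mathlib's `Aut`: `τ c (γ * γ') = τ c γ' ≫ τ c γ`; for a commutative `Γ` see `…_of_levelwise_comm`).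
* `exists_functor_action_iso_of_levelwise_comm` — the same for a commutative `Γ` with the covariant convention
  `τ c (γ * γ') = τ c γ ≫ τ c γ'`.
* `exists_functor_action_iso_of_levelwise'` — lifts hypothesised in the form `G.map m = e₀.hom ≫ g ≫ e₀.inv`
  (the literal output of a descent-of-morphisms lemma `∃! m, G.map m = g`).

Sources.  [GortzWedhorn2020] U. Görtz, T. Wedhorn, *Algebraic Geometry I*, 2nd ed., Thm. 14.72 (1) p. 457 (descent of
morphisms is unique, i.e. base change is faithful on descended morphisms) and Cor. 14.85 (Galois descent of
quasi-projective schemes), whose combination for diagrams is the tree's `GaloisDescentFunctor`; [Deligne1971TravauxShimura]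
Variante 5.9 p. 157 (functoriality of canonical models: the descended morphisms are unique, hence compose) and
[Milne2005ShimuraVarieties] Thm. 13.7 (b) p. 120 («a morphism of the complex varieties commuting with the Galois
actions is defined over `E`», uniqueness giving functoriality in the level).  Nothing here refers to Shimura
varieties or schemes; HC_CM is not proved here.

## References
* [GortzWedhorn2020] U. Görtz, T. Wedhorn, *Algebraic Geometry I: Schemes*, 2nd ed. (2020), Thm. 14.72, Cor. 14.85.
* [Deligne1971TravauxShimura] P. Deligne, *Travaux de Shimura*, Sém. Bourbaki 389 (1971), Variante 5.9.
* [Milne2005ShimuraVarieties] J. S. Milne, *Introduction to Shimura varieties* (2005), Thm. 13.7.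
-/

set_option autoImplicit false

namespace Literature.AlgebraicGeometry.Motives

open CategoryTheory

universe w v₁ v₂ v₃ u₁ u₂ u₃

variable {C : Type u₁} [Category.{v₁} C] {D : Type u₂} [Category.{v₂} D] {D' : Type u₃} [Category.{v₃} D']

namespace FaithfulTowerDescent

variable (G : D ⥤ D') (F : C ⥤ D') (N₀ : C → D) (e₀ : ∀ c, G.obj (N₀ c) ≅ F.obj c)

/-- **Uniqueness of lifts.**  Two morphisms `m, m' : N₀ c ⟶ N₀ c'` whose images under the faithful `G` induce the same
morphism `g : F.obj c ⟶ F.obj c'` through the comparisons `e₀` are equal.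
[cite: GortzWedhorn2020, Thm. 14.72 (1)] -/
theorem lift_unique [G.Faithful] {c c' : C} {g : F.obj c ⟶ F.obj c'} {m m' : N₀ c ⟶ N₀ c'}
    (hm : G.map m ≫ (e₀ c').hom = (e₀ c).hom ≫ g) (hm' : G.map m' ≫ (e₀ c').hom = (e₀ c).hom ≫ g) :
    m = m' :=
  G.map_injective (by rw [← cancel_mono (e₀ c').hom, hm, hm'])

/-- Lifts compose: a lift of `g` followed by a lift of `g'` is a lift of `g ≫ g'`. [cite: GortzWedhorn2020, Thm. 14.72 (1)] -/
theorem lift_comp {c c' c'' : C} {g : F.obj c ⟶ F.obj c'} {g' : F.obj c' ⟶ F.obj c''}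
    {m : N₀ c ⟶ N₀ c'} {m' : N₀ c' ⟶ N₀ c''}
    (hm : G.map m ≫ (e₀ c').hom = (e₀ c).hom ≫ g) (hm' : G.map m' ≫ (e₀ c'').hom = (e₀ c').hom ≫ g') :
    G.map (m ≫ m') ≫ (e₀ c'').hom = (e₀ c).hom ≫ (g ≫ g') := by
  rw [G.map_comp, Category.assoc, hm', reassoc_of% hm]

/-- The identity lifts the identity. [cite: GortzWedhorn2020, Thm. 14.72 (1)] -/
theorem lift_id (c : C) : G.map (𝟙 (N₀ c)) ≫ (e₀ c).hom = (e₀ c).hom ≫ 𝟙 (F.obj c) := by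
  rw [G.map_id, Category.id_comp, Category.comp_id]

end FaithfulTowerDescent

open FaithfulTowerDescent

/-- **Tower descent from levelwise descent (no translations).**  Let `G : D ⥤ D'` be faithful, `F : C ⥤ D'` a diagram,
`N₀ c` objects of `D` with comparisons `e₀ c : G.obj (N₀ c) ≅ F.obj c`, such that every transition map `F.map f` lifts
through the comparisons to a morphism `N₀ c ⟶ N₀ c'`.  Then there is a functor `N : C ⥤ D` with a natural isomorphism
`e : N ⋙ G ≅ F`, and every levelwise property `P` of the forms `(N₀ c, e₀ c)` holds for `(N.obj c, e.app c)`.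
(Functoriality = uniqueness of lifts, `lift_unique`.) [cite: GortzWedhorn2020, Thm. 14.72 (1) and Cor. 14.85]
[cite: Deligne1971TravauxShimura, Variante 5.9 p. 157] -/
theorem exists_functor_iso_of_levelwise (G : D ⥤ D') [G.Faithful] (F : C ⥤ D') (N₀ : C → D)
    (e₀ : ∀ c, G.obj (N₀ c) ≅ F.obj c)
    (P : ∀ c : C, ∀ Z : D, (G.obj Z ≅ F.obj c) → Prop) (hP : ∀ c, P c (N₀ c) (e₀ c))
    (hlift : ∀ {c c' : C} (f : c ⟶ c'), ∃ m : N₀ c ⟶ N₀ c', G.map m ≫ (e₀ c').hom = (e₀ c).hom ≫ F.map f) :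
    ∃ (N : C ⥤ D) (e : N ⋙ G ≅ F), ∀ c, P c (N.obj c) (e.app c) := by
  classical
  let N : C ⥤ D :=
    { obj := N₀
      map := fun f => (hlift f).choose
      map_id := fun c =>
        lift_unique G F N₀ e₀ (hlift (𝟙 c)).choose_spec (by rw [F.map_id]; exact lift_id G F N₀ e₀ c)
      map_comp := fun f g =>
        lift_unique G F N₀ e₀ (hlift (f ≫ g)).choose_spec
          (by rw [F.map_comp]; exact lift_comp G F N₀ e₀ (hlift f).choose_spec (hlift g).choose_spec) }
  let e : N ⋙ G ≅ F := NatIso.ofComponents (fun c => e₀ c) (fun f => (hlift f).choose_spec)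
  refine ⟨N, e, fun c => ?_⟩
  have happ : e.app c = e₀ c := NatIso.ofComponents.app _ _ _
  rw [happ]
  exact hP c

/-- **Tower descent WITH TRANSLATIONS from levelwise descent.**  As in `exists_functor_iso_of_levelwise`, and in
addition a group `Γ` acts levelwise on the diagram `F` by endomorphisms `τ c γ : F.obj c ⟶ F.obj c` — with
`τ c 1 = 𝟙`, `τ c (γ * γ') = τ c γ' ≫ τ c γ` (the multiplication convention of Mathlib's `Aut`), commuting with the
transition maps — and every `τ c γ` lifts through the comparison `e₀ c` to an endomorphism of `N₀ c`.  Then there are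
a functor `N : C ⥤ D`, group homomorphisms `ρ c : Γ →* Aut (N.obj c)` NATURAL in `c`, and a natural isomorphism
`e : N ⋙ G ≅ F` under which `G.map (ρ c γ)` is `τ c γ`; and every levelwise property of the given forms holds for
`(N.obj c, e.app c)`.  This is the MATRIX of the cell's leaf `Aux.canonicalModel_exists_ext_printed`/`ClosureDescent`
(`G :=` base change `E → ℂ`, `F :=` the complex tower, `Γ :=` the class group, `τ :=` the Hecke translations, `P :=`
reciprocity at one level), reduced to levelwise object and morphism descent.
[cite: GortzWedhorn2020, Thm. 14.72 (1) and Cor. 14.85] [cite: Deligne1971TravauxShimura, Variante 5.9 p. 157]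
[cite: Milne2005ShimuraVarieties, Thm. 13.7 (b) p. 120] -/
theorem exists_functor_action_iso_of_levelwise (G : D ⥤ D') [G.Faithful] (F : C ⥤ D') (N₀ : C → D)
    (e₀ : ∀ c, G.obj (N₀ c) ≅ F.obj c)
    {Γ : Type w} [Group Γ] (τ : ∀ c : C, Γ → (F.obj c ⟶ F.obj c))
    (hτ_one : ∀ c, τ c 1 = 𝟙 (F.obj c)) (hτ_mul : ∀ (c : C) (γ γ' : Γ), τ c (γ * γ') = τ c γ' ≫ τ c γ)
    (hτ_nat : ∀ {c c' : C} (f : c ⟶ c') (γ : Γ), τ c γ ≫ F.map f = F.map f ≫ τ c' γ)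
    (P : ∀ c : C, ∀ Z : D, (G.obj Z ≅ F.obj c) → Prop) (hP : ∀ c, P c (N₀ c) (e₀ c))
    (hlift : ∀ {c c' : C} (f : c ⟶ c'), ∃ m : N₀ c ⟶ N₀ c', G.map m ≫ (e₀ c').hom = (e₀ c).hom ≫ F.map f)
    (hliftτ : ∀ (c : C) (γ : Γ), ∃ r : N₀ c ⟶ N₀ c, G.map r ≫ (e₀ c).hom = (e₀ c).hom ≫ τ c γ) :
    ∃ (N : C ⥤ D) (ρ : ∀ c, Γ →* Aut (N.obj c)) (e : N ⋙ G ≅ F),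
      (∀ (c c' : C) (f : c ⟶ c') (γ : Γ), (ρ c γ).hom ≫ N.map f = N.map f ≫ (ρ c' γ).hom) ∧
      (∀ (c : C) (γ : Γ), G.map (ρ c γ).hom ≫ e.hom.app c = e.hom.app c ≫ τ c γ) ∧
      ∀ c, P c (N.obj c) (e.app c) := by
  classical
  -- the functor and the comparison, as in `exists_functor_iso_of_levelwise`
  let N : C ⥤ D :=
    { obj := N₀
      map := fun f => (hlift f).choose
      map_id := fun c =>
        lift_unique G F N₀ e₀ (hlift (𝟙 c)).choose_spec (by rw [F.map_id]; exact lift_id G F N₀ e₀ c)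
      map_comp := fun f g =>
        lift_unique G F N₀ e₀ (hlift (f ≫ g)).choose_spec
          (by rw [F.map_comp]; exact lift_comp G F N₀ e₀ (hlift f).choose_spec (hlift g).choose_spec) }
  have hNmap : ∀ {c c' : C} (f : c ⟶ c'), G.map (N.map f) ≫ (e₀ c').hom = (e₀ c).hom ≫ F.map f :=
    fun f => (hlift f).choose_spec
  let e : N ⋙ G ≅ F := NatIso.ofComponents (fun c => e₀ c) (fun f => hNmap f)
  -- the lifted translations: `r c γ` lifts `τ c γ`; they compose contravariantly and `r c 1 = 𝟙`
  let r : ∀ (c : C) (γ : Γ), N₀ c ⟶ N₀ c := fun c γ => (hliftτ c γ).choose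
  have hr : ∀ (c : C) (γ : Γ), G.map (r c γ) ≫ (e₀ c).hom = (e₀ c).hom ≫ τ c γ :=
    fun c γ => (hliftτ c γ).choose_spec
  have hr_one : ∀ c, r c 1 = 𝟙 (N₀ c) := fun c =>
    lift_unique G F N₀ e₀ (hr c 1) (by rw [hτ_one]; exact lift_id G F N₀ e₀ c)
  have hr_mul : ∀ (c : C) (γ γ' : Γ), r c (γ * γ') = r c γ' ≫ r c γ := fun c γ γ' =>
    lift_unique G F N₀ e₀ (hr c (γ * γ')) (by rw [hτ_mul]; exact lift_comp G F N₀ e₀ (hr c γ') (hr c γ))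
  have hr_inv_comp : ∀ (c : C) (γ : Γ), r c γ⁻¹ ≫ r c γ = 𝟙 (N₀ c) := fun c γ => by
    rw [← hr_mul, mul_inv_cancel, hr_one]
  have hr_comp_inv : ∀ (c : C) (γ : Γ), r c γ ≫ r c γ⁻¹ = 𝟙 (N₀ c) := fun c γ => by
    rw [← hr_mul, inv_mul_cancel, hr_one]
  -- the action by automorphisms
  let ρ : ∀ c, Γ →* Aut (N.obj c) := fun c =>
    { toFun := fun γ => ⟨r c γ, r c γ⁻¹, hr_comp_inv c γ, hr_inv_comp c γ⟩
      map_one' := Aut.ext (hr_one c)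
      map_mul' := fun γ γ' => Aut.ext (hr_mul c γ γ') }
  have hρ : ∀ (c : C) (γ : Γ), (ρ c γ).hom = r c γ := fun _ _ => rfl
  refine ⟨N, ρ, e, fun c c' f γ => ?_, fun c γ => ?_, fun c => ?_⟩
  · -- naturality of `ρ` in the level: both sides lift `τ c γ ≫ F.map f = F.map f ≫ τ c' γ`
    rw [hρ, hρ]
    refine lift_unique G F N₀ e₀ (lift_comp G F N₀ e₀ (hr c γ) (hNmap f)) ?_
    rw [hτ_nat]
    exact lift_comp G F N₀ e₀ (hNmap f) (hr c' γ)
  · -- `G.map (ρ c γ)` is `τ c γ` under `e`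
    have happ : e.hom.app c = (e₀ c).hom := rfl
    rw [hρ, happ]
    exact hr c γ
  · have happ : e.app c = e₀ c := NatIso.ofComponents.app _ _ _
    rw [happ]
    exact hP c

/-- **Commutative translations, covariant convention.**  `exists_functor_action_iso_of_levelwise` for a commutative
group `Γ` whose levelwise action is written covariantly, `τ c (γ * γ') = τ c γ ≫ τ c γ'` (e.g. the class-group
translations of a tower of Shimura varieties, `translMorExt K (c * c')`). [cite: Deligne1971TravauxShimura, Variante 5.9 p. 157]
[cite: Milne2005ShimuraVarieties, Thm. 13.7 (b) p. 120] -/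
theorem exists_functor_action_iso_of_levelwise_comm (G : D ⥤ D') [G.Faithful] (F : C ⥤ D') (N₀ : C → D)
    (e₀ : ∀ c, G.obj (N₀ c) ≅ F.obj c)
    {Γ : Type w} [CommGroup Γ] (τ : ∀ c : C, Γ → (F.obj c ⟶ F.obj c))
    (hτ_one : ∀ c, τ c 1 = 𝟙 (F.obj c)) (hτ_mul : ∀ (c : C) (γ γ' : Γ), τ c (γ * γ') = τ c γ ≫ τ c γ')
    (hτ_nat : ∀ {c c' : C} (f : c ⟶ c') (γ : Γ), τ c γ ≫ F.map f = F.map f ≫ τ c' γ)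
    (P : ∀ c : C, ∀ Z : D, (G.obj Z ≅ F.obj c) → Prop) (hP : ∀ c, P c (N₀ c) (e₀ c))
    (hlift : ∀ {c c' : C} (f : c ⟶ c'), ∃ m : N₀ c ⟶ N₀ c', G.map m ≫ (e₀ c').hom = (e₀ c).hom ≫ F.map f)
    (hliftτ : ∀ (c : C) (γ : Γ), ∃ r : N₀ c ⟶ N₀ c, G.map r ≫ (e₀ c).hom = (e₀ c).hom ≫ τ c γ) :
    ∃ (N : C ⥤ D) (ρ : ∀ c, Γ →* Aut (N.obj c)) (e : N ⋙ G ≅ F),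
      (∀ (c c' : C) (f : c ⟶ c') (γ : Γ), (ρ c γ).hom ≫ N.map f = N.map f ≫ (ρ c' γ).hom) ∧
      (∀ (c : C) (γ : Γ), G.map (ρ c γ).hom ≫ e.hom.app c = e.hom.app c ≫ τ c γ) ∧
      ∀ c, P c (N.obj c) (e.app c) :=
  exists_functor_action_iso_of_levelwise G F N₀ e₀ τ hτ_one (fun c γ γ' => by rw [mul_comm]; exact hτ_mul c γ' γ)
    hτ_nat P hP hlift hliftτ

/-- **Variant with lifts in «descended-morphism» form.**  The lift hypotheses stated as the literal output of a
descent-of-morphisms lemma `∃ m, G.map m = g` applied to `g := e₀.hom ≫ F.map f ≫ e₀.inv`, resp.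
`g := e₀.hom ≫ τ c γ ≫ e₀.inv` (e.g. the tree's `GaloisDescent.existsUnique_map_eq_complex`, [Milne2005ShimuraVarieties]
Prop. 13.1 / Thm. 13.7 (b)). [cite: Milne2005ShimuraVarieties, Thm. 13.7 (b) p. 120] [cite: GortzWedhorn2020, Thm. 14.72 (1)] -/
theorem exists_functor_action_iso_of_levelwise' (G : D ⥤ D') [G.Faithful] (F : C ⥤ D') (N₀ : C → D)
    (e₀ : ∀ c, G.obj (N₀ c) ≅ F.obj c)
    {Γ : Type w} [Group Γ] (τ : ∀ c : C, Γ → (F.obj c ⟶ F.obj c))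
    (hτ_one : ∀ c, τ c 1 = 𝟙 (F.obj c)) (hτ_mul : ∀ (c : C) (γ γ' : Γ), τ c (γ * γ') = τ c γ' ≫ τ c γ)
    (hτ_nat : ∀ {c c' : C} (f : c ⟶ c') (γ : Γ), τ c γ ≫ F.map f = F.map f ≫ τ c' γ)
    (P : ∀ c : C, ∀ Z : D, (G.obj Z ≅ F.obj c) → Prop) (hP : ∀ c, P c (N₀ c) (e₀ c))
    (hlift : ∀ {c c' : C} (f : c ⟶ c'), ∃ m : N₀ c ⟶ N₀ c', G.map m = (e₀ c).hom ≫ F.map f ≫ (e₀ c').inv)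
    (hliftτ : ∀ (c : C) (γ : Γ), ∃ r : N₀ c ⟶ N₀ c, G.map r = (e₀ c).hom ≫ τ c γ ≫ (e₀ c).inv) :
    ∃ (N : C ⥤ D) (ρ : ∀ c, Γ →* Aut (N.obj c)) (e : N ⋙ G ≅ F),
      (∀ (c c' : C) (f : c ⟶ c') (γ : Γ), (ρ c γ).hom ≫ N.map f = N.map f ≫ (ρ c' γ).hom) ∧
      (∀ (c : C) (γ : Γ), G.map (ρ c γ).hom ≫ e.hom.app c = e.hom.app c ≫ τ c γ) ∧
      ∀ c, P c (N.obj c) (e.app c) := by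
  refine exists_functor_action_iso_of_levelwise G F N₀ e₀ τ hτ_one hτ_mul hτ_nat P hP ?_ ?_
  · intro c c' f
    obtain ⟨m, hm⟩ := hlift f
    exact ⟨m, by rw [hm, Category.assoc, Category.assoc, Iso.inv_hom_id, Category.comp_id]⟩
  · intro c γ
    obtain ⟨r, hr⟩ := hliftτ c γ
    exact ⟨r, by rw [hr, Category.assoc, Category.assoc, Iso.inv_hom_id, Category.comp_id]⟩

end Literature.AlgebraicGeometry.Motives
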